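import Summits.QuantumFields.YangMills.Theorems.AlphaInputsT3ACv4Lane
import HarnessLib

/-!
# `UnitScaleTiltHistoryTailCoreRunRowsRows` — crux `HistoryTailL` (stmt-QuantumFields-19936), v4 package chain (★★OWNER RULING g26-№14, F-2b; ★alpha-2 g7 W-hand checklist P5–P20):
# the ADDITIVE TWIN of ✓`UnitScaleTiltHistoryTailCoreRunRows` §1 for a VERSION-4 core run `AlphaV4AC.RunAlphaV4CoreAC` — (46) p.267 one step up,
# `|Pint_{k+1}(h, U)| ≤ (C46·M₁³)·(g_kp(g_k))²·#Ω_{k+1}^{(k+1)}(h)` — width seat 19936-w6 (g2); `--supports` 19936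

WHY.  The v3 → v4 change is `hLF67 ↦ h71` ((71) per recorded plaquette, `AlphaInputsT3ACv4Lane`); (46) reads only the `steps` rows, which are byte-identical, so the proof is
✓`AlphaV3AC.abs_Pint_succ_le_of_alphaV3Core`'s VERBATIM with `R : RunAlphaV3CoreAC ↦ AlphaV4AC.RunAlphaV4CoreAC`.  Consumer: the twin `…IntPintRows` of ✓`…HistoryTailIntPint`
(`PkgCoreRows.abs_Pint_succ_le` at `(q K).runRows`).  §2 of the v3 file ((71) for a core run) is already ✓`AlphaV4AC.eq71_perPlaquette_of_alphaV4Core` (a field read) — not repeated.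
Nothing of [Balaban1985UV3] is asserted; CONDITIONAL only on the v4 core run `R`.  YM₃ on T³ = rung R3 (finite-torus SU(2)), not the continuum, not the Clay problem; no mass gap claimed.

References: T. Bałaban, Commun. Math. Phys. 102 (1985) 255–275 [Balaban1985UV3] ((33)–(34) p.264, (44)–(46) p.267, (61) p.271).
-/

set_option autoImplicit false

noncomputable section

namespace Summit.QuantumFields.YangMills.Theorems

open MeasureTheory
open scoped BigOperators Matrix.Norms.L2Operator
open Literature.MathematicalPhysics.QuantumFieldTheory.Balaban1983to89
open Literature.MathematicalPhysics.QuantumFieldTheory.Balaban1985CMP102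
open Literature.MathematicalPhysics.QuantumFieldTheory.Balaban1985CMP102.Setting
open Summit.QuantumFields.Balaban3D.Carriers
open Summit.QuantumFields.Balaban3D.Proofs.Primitives
open Summit.QuantumFields.Balaban3D.Proofs.UVStability3DInputs (adjAct)
open Summit.QuantumFields.Balaban3D.Proofs.GroupModelLieC (lieC)
open Summit.QuantumFields.Balaban3D.Proofs.FamilyLE (thresholds_of_le)
open Summit.QuantumFields.Balaban3D.Proofs.TowerAC
open Summit.QuantumFields.Balaban3D.Proofs.StandardAC
open Summit.QuantumFields.Balaban3D.Proofs.InputsAC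
open Summit.QuantumFields.Balaban3D.Proofs.AlphaAC (AlphaDataAC)
open Summit.QuantumFields.Balaban3D.Proofs.Bound46AC (abs_pint_le_stdAC)

/-! ## §1 (46) one step up for the AC tower of a VERSION-4 core (α) run, on the `≤`-family -/

namespace AlphaV4AC

variable {L : ℕ} {S : Scales L} {G : Type} [GaugeGroup G] [MeasurableSpace G] [HaarData G] {𝔊 : GroupModel G} {𝔠 : AlphaConsts L 𝔊.N}
  {X : ExternalInputsAC S G} {𝔖 : ∀ k, StepSeries S G ↥(lieC 𝔊) (nblkOf S 𝔠.lane.carrier k) k} {𝔄 : AlphaDataAC 𝔊 𝔠 X 𝔖}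
  {win : (k : ℕ) → Hist S.P (k + 1) → Set (GaugeField S.P (k + 1) G)}
  (hle : S.g ^ 2 * S.ε₀ ≤ (min 𝔠.gamma0 1) ^ 2)
include hle

/-- **(46) FOR THE AC TOWER OF A VERSION-4 CORE (α) RUN `RunAlphaV4CoreAC`, ONE STEP UP, every `k < K`** (on the `≤`-family `g²ε₀ ≤ (min γ₀ 1)²`):
`|Pint_{k+1}(h, U)| ≤ (C46·M₁³)·(g_kp(g_k))²·#Ω_{k+1}^{(k+1)}(h)` — `Bound46AC.abs_pint_le_stdAC` fed by the step rows `h44`/`hfloor` (old slice), `chart`/`bound28`/`far_le`/`hPY`/`hPYZ`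
+ `𝔄.Λc`/`𝔄.N45` (newborn slice), the thresholds `γ₄₆` and the (28)-smallness from `g_k ≤ γ₀` (`FamilyLE.thresholds_of_le`); the twin of ✓`AlphaV3AC.abs_Pint_succ_le_of_alphaV3Core`
(only `steps` is read, and `steps` is unchanged from v3). [cite: Balaban1985UV3, (44)–(46) p.267 + (33)–(34) p.264 + (61) p.271] -/
theorem abs_Pint_succ_le_of_alphaV4Core (R : RunAlphaV4CoreAC 𝔊 𝔠 X 𝔖 𝔄 win) (k : ℕ) (hk : k + 1 ≤ S.K) (h : Hist S.P (k + 1))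
    (U : GaugeField S.P (k + 1) G) :
    |(inputOfAC 𝔠.lane X 𝔖).Pint (k + 1) h U| ≤
      (𝔠.C46 * (𝔠.M₁ : ℝ) ^ 3) * (S.gk k * B10.pFun 𝔠.b₀ 𝔠.p₀ (S.gk k)) ^ 2 * (LamFin 𝔠.lane.carrier.M₁ (rcolOf S 𝔠.lane.carrier) k h).card := by
  rw [𝔠.C46_mul_M₁_cube_eq]
  exact abs_pint_le_stdAC X 𝔠.lane.carrier 𝔖 𝔠.C44_nonneg 𝔠.B₃_pos.le 𝔠.κ₁_pos 𝔠.M₁_pos 𝔠.b₀_pos 𝔠.p₀_pos 𝔠.chart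
    (by linarith [𝔠.kappa_ge]) 𝔠.C25_nonneg 𝔠.C63_nonneg (lt_of_lt_of_le one_pos 𝔠.one_le_r₀)
    (fun j hj => (R.steps j hj).h44) (fun j hj => (R.steps j hj).hfloor) (fun j hj => (thresholds_of_le hle j (by omega)).2.1)
    (fun j hj => (R.steps j hj).chart) (fun j hj => (R.steps j hj).bound28) (fun j hj => (thresholds_of_le hle j (by omega)).2.2.2.2)
    (fun j hj => (R.steps j hj).far_le) (fun j hj => (R.steps j hj).hPY) (π := fun j => adjAct 𝔊 (P := S.P) j) (fun j _ => 𝔄.Λc j)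
    (fun j _ => 𝔄.N45 j) (fun j hj => (R.steps j hj).hPYZ) k hk h U

/-- The same through the v4 χ-record (`RunAlphaV4ChiAC.toCore`). [cite: Balaban1985UV3, (46) p.267] -/
theorem abs_Pint_succ_le_of_alphaV4Chi (R : RunAlphaV4ChiAC 𝔊 𝔠 X 𝔖 𝔄 win) (k : ℕ) (hk : k + 1 ≤ S.K) (h : Hist S.P (k + 1))
    (U : GaugeField S.P (k + 1) G) :
    |(inputOfAC 𝔠.lane X 𝔖).Pint (k + 1) h U| ≤
      (𝔠.C46 * (𝔠.M₁ : ℝ) ^ 3) * (S.gk k * B10.pFun 𝔠.b₀ 𝔠.p₀ (S.gk k)) ^ 2 * (LamFin 𝔠.lane.carrier.M₁ (rcolOf S 𝔠.lane.carrier) k h).card :=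
  abs_Pint_succ_le_of_alphaV4Core hle R.toCore k hk h U

end AlphaV4AC

end Summit.QuantumFields.YangMills.Theorems

end
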